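import Mathlib.Data.Int.LeastGreatest
import Literature.IUT.LogVolume.TensorPacketOrbitSpan
import Literature.IUT.LogVolume.TensorPacketOrbits
import HarnessLib

/-!
# Every nonzero bounded region of a tensor packet has a CONTENT `m`, and the hull of its (Ind2)-orbit is
# `hull(p^m · log_p(R_I^×))` (Weil, *Basic Number Theory* Ch. II §2 Th. 2; Dupuy–Hilado §4.9–4.12)

Sequel to `TensorPacketOrbitSpan.lean` (the hull LOWER bound of `HOME/skel/FORK-REAL-MODEL.md` §4), closing
its last free parameter: there the two-sided statement `hull(⋃_{g ∈ Ind2} g·M) = hull(p^m·log_p(R_I^×))` was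
proved for a region `M ⊆ p^m·log_p(R_I^×)` containing a vector outside `p^{m+1}·log_p(R_I^×)`. HERE: such an
`m` EXISTS (and is unique) for EVERY bounded region `M ⊄ {0}` of the packet `V = ⊗_{ℚ_p} k_i` —
`exists_content` (bounded ⇒ `M ⊆ p^{−N}·log_p(R_I^×)`, abc-iut-c312-d1/S2's `exists_subset_ppow_smul_logPacket`;
a nonzero vector leaves `p^m·log_p(R_I^×)` for `m ≫ 0`; take the greatest admissible `m`), `content_unique`.
Consequently (**`exists_packetHull_orbit_eq_zpow`**): for every bounded region `M ⊄ {0}` there is an `m ∈ ℤ`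
with `M ⊆ p^m·log_p(R_I^×)`, `M ⊄ p^{m+1}·log_p(R_I^×)` and

  `hull(⋃_{g ∈ Ind2} g·M) = hull(p^m · log_p(R_I^×))`

— with the FULL (Ind2) group `Aut_{ℚ_p}(V : log_p(R_I^×))` of the real packet model, the hull of the (Ind2)-orbit
of a region depends on the region only through ONE integer (its content with respect to the log-shell
lattice). Read with skeleton XXVI (`Summits/ABC/IUTFork/ForkPacketReal.lean`): the upper bound there
([IUTchIV] Step (v), `thetaHull_bound`) and this identity bracket the Θ-hull at a summand between
`hull(p^m·log_p(R_I^×))` for the content `m` of the bare Θ-region (determined by `ord(t)` and the [IUTchIV] Prop.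
1.2 sandwich `⊗α_i·R_I ⊆ log_p(R_I^×) ⊆ ⊗h_i·(R_I)^∼`, `TensorPacketShell`) — the bookkeeping of that `m` is
the consumer's. [cite: WeilBNT1967, Ch. II §2, Th. 2] [cite: DupuyHilado2025, §4.9, §4.12] No side is taken on
[IUTchIII] Cor. 3.12; (Ind2)/the hull are the tree's typings of disputed-corpus constructions
[claim: Mochizuki2012, status: disputed]. PROOF-ONLY file: no definitions, no named `Prop` facts.
-/

noncomputable section

open Set Module
open scoped Pointwise TensorProduct

namespace Literature.IUT.LogVolume

variable (p : ℕ) [Fact p.Prime]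
variable {I : Type} [Fintype I] [DecidableEq I] [Nonempty I]
variable (k : I → Type) [∀ i, NontriviallyNormedField (k i)] [∀ i, NormedAlgebra ℚ_[p] (k i)]
  [∀ i, IsUltrametricDist (k i)] [∀ i, ProperSpace (k i)]

omit [Fintype I] [DecidableEq I] [Nonempty I] [∀ i, IsUltrametricDist (k i)] [∀ i, ProperSpace (k i)] in
/-- The packet element `p^n = algebraMap ℚ_p V (p^n)` acts on regions as the scalar `p^n ∈ ℚ_p`.
[cite: DupuyHilado2025, §4 (intro)] -/
theorem ppow_smul_set_eq (n : ℤ) (A : Set (PacketAlgebra p k)) :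
    ppow p k n • A = ((p : ℚ_[p]) ^ n) • A := by
  ext y
  rw [Set.mem_smul_set, Set.mem_smul_set]
  have h : ∀ x : PacketAlgebra p k, ppow p k n • x = ((p : ℚ_[p]) ^ n) • x := fun x => by
    rw [ppow, smul_eq_mul, Algebra.smul_def]
  simp only [h]

/-- `p^{m'}·log_p(R_I^×) ⊆ p^m·log_p(R_I^×)` for `m ≤ m'` (`log_p(R_I^×)` is a `ℤ_p`-module).
[cite: WeilBNT1967, Ch. II §2, Th. 2] -/
theorem zpow_smul_logPacket_anti {m m' : ℤ} (h : m ≤ m') :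
    ((p : ℚ_[p]) ^ m') • (logPacket p k : Set (PacketAlgebra p k)) ⊆
      ((p : ℚ_[p]) ^ m) • (logPacket p k : Set (PacketAlgebra p k)) := by
  obtain ⟨κ, _, B, hB⟩ := exists_basisLattice_eq_logPacket p k
  have hp0 : (p : ℚ_[p]) ≠ 0 := Nat.cast_ne_zero.mpr (Fact.out : p.Prime).ne_zero
  rintro _ ⟨y, hy, rfl⟩
  refine ⟨((p : ℚ_[p]) ^ (m' - m)) • y, ?_, ?_⟩
  · rw [SetLike.mem_coe, ← hB] at hy ⊢
    refine PadicModule.smul_mem_basisLattice p B ?_ hy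
    rw [Padic.norm_p_zpow]
    exact zpow_le_one_of_nonpos₀ (by exact_mod_cast (Fact.out : p.Prime).one_lt.le) (by omega)
  · change ((p : ℚ_[p]) ^ m) • (((p : ℚ_[p]) ^ (m' - m)) • y) = ((p : ℚ_[p]) ^ m') • y
    rw [smul_smul, ← zpow_add₀ hp0, add_sub_cancel]

/-- **Every nonzero bounded region has a content**: for `M` bounded (`IsPsiBounded`) with a nonzero element
there is `m ∈ ℤ` with `M ⊆ p^m·log_p(R_I^×)` and `M ⊄ p^{m+1}·log_p(R_I^×)`.
[cite: WeilBNT1967, Ch. II §2, Th. 2] [cite: DupuyHilado2025, §4.12] -/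
theorem exists_content {M : Set (PacketAlgebra p k)} (hMb : IsPsiBounded p k M) (hM0 : ∃ x ∈ M, x ≠ 0) :
    ∃ m : ℤ, M ⊆ ((p : ℚ_[p]) ^ m) • (logPacket p k : Set (PacketAlgebra p k)) ∧
      ¬ M ⊆ ((p : ℚ_[p]) ^ (m + 1)) • (logPacket p k : Set (PacketAlgebra p k)) := by
  obtain ⟨κ, _, B, hB⟩ := exists_basisLattice_eq_logPacket p k
  obtain ⟨x, hxM, hx0⟩ := hM0
  -- below: `M ⊆ p^{-N}·log_p(R_I^×)`
  obtain ⟨N, hN⟩ := exists_subset_ppow_smul_logPacket p k hMb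
  rw [ppow_smul_set_eq] at hN
  -- above: a nonzero coordinate of `x` bounds the content
  have hx' : ∃ i, B.repr x i ≠ 0 := by
    by_contra h
    exact hx0 (B.repr.injective (Finsupp.ext fun i => by
      rw [map_zero, Finsupp.zero_apply]; exact not_not.mp fun hi => h ⟨i, hi⟩))
  obtain ⟨i, hi⟩ := hx'
  have hp1 : (1 : ℝ) < p := by exact_mod_cast (Fact.out : p.Prime).one_lt
  obtain ⟨n, hn⟩ := exists_pow_lt_of_lt_one (norm_pos_iff.mpr hi) (inv_lt_one_of_one_lt₀ hp1)
  have hbdd : ∀ m : ℤ, M ⊆ ((p : ℚ_[p]) ^ m) • (logPacket p k : Set (PacketAlgebra p k)) → m ≤ n := by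
    intro m hm
    by_contra hlt
    rw [not_le] at hlt
    obtain ⟨y, hy, hxy⟩ := Set.mem_smul_set.mp (hm hxM)
    rw [SetLike.mem_coe, ← hB] at hy
    have hyi : ‖B.repr y i‖ ≤ 1 := (PadicModule.mem_basisLattice p B).mp hy i
    have hcoord : B.repr x i = (p : ℚ_[p]) ^ m * B.repr y i := by
      rw [← hxy, map_smul, Finsupp.smul_apply, smul_eq_mul]
    have hle : ‖B.repr x i‖ ≤ ((p : ℝ)⁻¹) ^ n := by
      rw [hcoord, norm_mul, Padic.norm_p_zpow]
      calc (p : ℝ) ^ (-m) * ‖B.repr y i‖ ≤ (p : ℝ) ^ (-m) * 1 :=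
            mul_le_mul_of_nonneg_left hyi (zpow_nonneg (by positivity) _)
        _ ≤ (p : ℝ) ^ (-(n : ℤ)) := by
            rw [mul_one]; exact zpow_le_zpow_right₀ hp1.le (by omega)
        _ = ((p : ℝ)⁻¹) ^ n := by rw [zpow_neg, zpow_natCast, inv_pow]
    exact (hle.trans_lt hn).false
  obtain ⟨m₀, hm₀, hmax⟩ :=
    Int.exists_greatest_of_bdd ⟨n, hbdd⟩ ⟨-(N : ℤ), hN⟩
  exact ⟨m₀, hm₀, fun h => by have := hmax _ h; omega⟩

/-- **The content is unique.** [cite: WeilBNT1967, Ch. II §2, Th. 2] -/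
theorem content_unique {M : Set (PacketAlgebra p k)} {m m' : ℤ}
    (hm : M ⊆ ((p : ℚ_[p]) ^ m) • (logPacket p k : Set (PacketAlgebra p k)))
    (hm1 : ¬ M ⊆ ((p : ℚ_[p]) ^ (m + 1)) • (logPacket p k : Set (PacketAlgebra p k)))
    (hm' : M ⊆ ((p : ℚ_[p]) ^ m') • (logPacket p k : Set (PacketAlgebra p k)))
    (hm1' : ¬ M ⊆ ((p : ℚ_[p]) ^ (m' + 1)) • (logPacket p k : Set (PacketAlgebra p k))) : m = m' := by
  by_contra hne
  rcases lt_or_gt_of_ne hne with h | h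
  · exact hm1 (hm'.trans (zpow_smul_logPacket_anti p k (by omega)))
  · exact hm1' (hm.trans (zpow_smul_logPacket_anti p k (by omega)))

/-- **The hull of the (Ind2)-orbit of ANY nonzero bounded region is the hull of a scalar multiple of the
log-shell lattice**: `∃ m, M ⊆ p^m·log_p(R_I^×) ∧ M ⊄ p^{m+1}·log_p(R_I^×) ∧ hull(⋃_{g ∈ Ind2} g·M) =
hull(p^m·log_p(R_I^×))`. [cite: WeilBNT1967, Ch. II §2, Th. 2] [cite: DupuyHilado2025, §4.9, §4.12] -/
theorem exists_packetHull_orbit_eq_zpow {M : Set (PacketAlgebra p k)} (hMb : IsPsiBounded p k M)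
    (hM0 : ∃ x ∈ M, x ≠ 0) :
    ∃ m : ℤ, M ⊆ ((p : ℚ_[p]) ^ m) • (logPacket p k : Set (PacketAlgebra p k)) ∧
      ¬ M ⊆ ((p : ℚ_[p]) ^ (m + 1)) • (logPacket p k : Set (PacketAlgebra p k)) ∧
      packetHull p k (⋃ g : indTwo p k, g • M) =
        packetHull p k (((p : ℚ_[p]) ^ m) • (logPacket p k : Set (PacketAlgebra p k))) := by
  obtain ⟨m, hm, hm1⟩ := exists_content p k hMb hM0
  obtain ⟨x, hxM, hx⟩ := Set.not_subset.mp hm1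
  exact ⟨m, hm, hm1, packetHull_orbit_eq_zpow p k hxM hx hm⟩

/-- In particular **two bounded nonzero regions of the same content have (Ind2)-orbits with the SAME hull**.
[cite: DupuyHilado2025, §4.9, §4.12] -/
theorem packetHull_orbit_eq_of_content_eq {M M' : Set (PacketAlgebra p k)} {m : ℤ} {x x' : PacketAlgebra p k}
    (hxM : x ∈ M) (hx : x ∉ ((p : ℚ_[p]) ^ (m + 1)) • (logPacket p k : Set (PacketAlgebra p k)))
    (hM : M ⊆ ((p : ℚ_[p]) ^ m) • (logPacket p k : Set (PacketAlgebra p k)))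
    (hxM' : x' ∈ M') (hx' : x' ∉ ((p : ℚ_[p]) ^ (m + 1)) • (logPacket p k : Set (PacketAlgebra p k)))
    (hM' : M' ⊆ ((p : ℚ_[p]) ^ m) • (logPacket p k : Set (PacketAlgebra p k))) :
    packetHull p k (⋃ g : indTwo p k, g • M) = packetHull p k (⋃ g : indTwo p k, g • M') := by
  rw [packetHull_orbit_eq_zpow p k hxM hx hM, packetHull_orbit_eq_zpow p k hxM' hx' hM']

end Literature.IUT.LogVolume

end
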